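import Summits.BirchSwinnertonDyer.Rank1Residual.Additive.LocalSubgroupTransport
import Literature.NumberTheory.EllipticCurves.Kobayashi2003.SignedSelmer
import HarnessLib

/-!
# Model transport for Kobayashi's local layer objects along an isomorphism of algebraic closures — file 1 of 2 (the engine) of the
# transport of the plus Honda system at `2` (HONDA⁺@2, K4 `SignedControlAtTwo`, stmt-BirchSwinnertonDyer-20309, line `eulerchar` v6
# stub `stub_plusHondaSystemTwo`) from Mathlib's `ℚ_[2]` to the completion `ℚ_v`

Route `ThetaPartnerAtTwo` (TP2; crux shared with RTT), crux K4, line `eulerchar` v6 (8d2b4be25f391f24, lead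
`prover-bsd-wall-tp2-p3` g2); seat `prover-bsd-wall-tp2-p3-w3` (width seat 3/3).

WHY. The only research stub left on the line, `stub_plusHondaSystemTwo` (HONDA⁺@2), is a statement about the tree's local
objects `localPoints W ℚ_v`, `localLayerPointsOfEmb κ (closureEmb ℚ_v) W m`, `localTraceOfEmb κ (closureEmb ℚ_v) W _ _` and
`ℤ[Γ_{ℚ_v}]`-orbits at the COMPLETION `ℚ_v = v.adicCompletion ℚ` (`v ∋ 2`) with the CHOSEN embedding `closureEmb`, whereas the
`p = 2` local theory being built for it (K3 lead `tp2-p2x`, `Theorems/ThetaPartnerAtTwoSignedKatoUpToAtTwoLocal*.lean`) lives over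
Mathlib's MODEL `ℚ_[2]` and an ARBITRARY embedding `ι : ℚ̄ → ℚ̄₂`. File 2 (`…PlusHondaTransport`) moves a Honda system from
(`ℚ_[p]`, every `ι`) to (`ℚ_v`, `closureEmb`); this file is the generic engine.

WHAT (any field `K`, `K`-fields `E`, `E'`, a `K`-isomorphism `Φ : Ē ≃ₐ[K] Ē'` of algebraic closures lying over a field
isomorphism `φ : E ≃+* E'` (`hf`), embeddings `ι : K̄ → Ē`, `ι' : K̄ → Ē'` with `ι' = Φ ∘ ι`, and the coordinate map
`T = Φ_* : E(Ē) → E(Ē')` — given abstractly by `hT : T P = Point.map Φ P`, so that NO definition is introduced; the Galois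
transport is the tree's `LocalTransport.transportAut` `h ↦ Φ h Φ⁻¹`):
* §1 `Φ h Φ⁻¹ ∈ Γ_{E'}` and `Φ⁻¹ t Φ ∈ Γ_E` are mutually inverse (`transportAut_transportAut_symm_model`, `…symm…`), the
  restrictions to `Γ_K` match (`resGalOfEmb_transportAut_model`: `res_{ι'}(Φ h Φ⁻¹) = res_ι h`), so the local subgroups
  `H_ι`, `H_{ι'}` of any `H ≤ Γ_K` correspond (`transportAut_mem_localSubgroupOfEmb_iff_model`).
* §2 `T (h • P) = (Φ h Φ⁻¹) • T P` (`modelMap_smul`), `T` is onto (`modelMap_surjective`; injective as `Point.map Φ`), the layer points correspond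
  (`modelMap_mem_localLayerPointsOfEmb_iff`: `T P ∈ E(K_n·E') ↔ P ∈ E(K_n·E)`), the traces correspond on layer points
  (`modelMap_localTraceOfEmb`, by re-indexing the coset sums along `Φ(·)Φ⁻¹` — the pattern of the tree's
  `EtaLayer.transportPoints_localPairTraceOfEmb`), and orbit closures correspond (`map_modelMap_closure_orbit`).

HONEST FRAMING: THEOREMS ONLY (no definition, no named fact, no instance, no `sorry`), route-independent (no `Theses` import);
Galois-theoretic bookkeeping (Serre, *Galois Cohomology* II.§1.1); closes nothing by itself; BSD is not proved by any of this.

References: [SerreGaloisCohomology1997] J.-P. Serre, *Galois Cohomology*, I.§2.4, II.§1.1; [SilvermanAEC2009] J. H. Silverman,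
*The Arithmetic of Elliptic Curves*, 2nd ed., VIII.§1, X.§4; [Kobayashi2003] S. Kobayashi, Invent. Math. 152 (2003), Def. 1.1;
[GreenbergLNM1716] R. Greenberg, LNM 1716 (1999), §2; [MilneFT2022] J. S. Milne, *Fields and Galois Theory*, Ch. 6.
-/

set_option autoImplicit false
-- the Theorems namespace of this sub repeats the summit name by design (D-0017 nested layout)
set_option linter.dupNamespace false

noncomputable section

open scoped Classical NumberField

open NumberField IsDedekindDomain WeierstrassCurve Literature.NumberTheory.EllipticCurves
  Literature.NumberTheory.EllipticCurves.Kobayashi2003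
  Summit.BirchSwinnertonDyer.Rank1Residual.Additive.LocalTransport

universe u

namespace Summit.BirchSwinnertonDyer.BirchSwinnertonDyer.Theorems.SignedEC

section Generic

variable {K : Type u} [Field K] {E : Type u} [Field E] [Algebra K E] {E' : Type u} [Field E'] [Algebra K E']
  (Φ : AlgebraicClosure E ≃ₐ[K] AlgebraicClosure E') (φ : E ≃+* E')
  (hf : ∀ y : E, Φ (algebraMap E (AlgebraicClosure E) y) = algebraMap E' (AlgebraicClosure E') (φ y))

/-! ## §1 Conjugation of Galois elements along `Φ` -/

include hf in
/-- Every `h ∈ Γ_E` fixes `Φ⁻¹(E') = E` pointwise — the fixing hypothesis of `transportAut Φ` (`h ↦ Φ h Φ⁻¹ ∈ Γ_{E'}`).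
[cite: SerreGaloisCohomology1997, II.§1.1] -/
theorem modelFix (h : Field.absoluteGaloisGroup E) (y : E') :
    (show AlgebraicClosure E ≃ₐ[E] AlgebraicClosure E from h)
        (Φ.toRingEquiv.symm (algebraMap E' (AlgebraicClosure E') y)) =
      Φ.toRingEquiv.symm (algebraMap E' (AlgebraicClosure E') y) := by
  have h1 : Φ.toRingEquiv.symm (algebraMap E' (AlgebraicClosure E') y) =
      algebraMap E (AlgebraicClosure E) (φ.symm y) := by
    apply Φ.toRingEquiv.injective
    rw [RingEquiv.apply_symm_apply]
    change _ = Φ _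
    rw [hf, RingEquiv.apply_symm_apply]
  rw [h1]
  exact AlgEquiv.commutes _ _

include hf in
/-- Every `t ∈ Γ_{E'}` fixes `Φ(E) = E'` pointwise — the fixing hypothesis of `transportAut Φ⁻¹` (`t ↦ Φ⁻¹ t Φ ∈ Γ_E`).
[cite: SerreGaloisCohomology1997, II.§1.1] -/
theorem modelFix_symm (t : Field.absoluteGaloisGroup E') (y : E) :
    (show AlgebraicClosure E' ≃ₐ[E'] AlgebraicClosure E' from t)
        (Φ.toRingEquiv.symm.symm (algebraMap E (AlgebraicClosure E) y)) =
      Φ.toRingEquiv.symm.symm (algebraMap E (AlgebraicClosure E) y) := by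
  rw [RingEquiv.symm_symm]
  change _ = Φ _
  change (show AlgebraicClosure E' ≃ₐ[E'] AlgebraicClosure E' from t) (Φ _) = _
  rw [hf]
  exact AlgEquiv.commutes _ _

/-- Values of `Φ h Φ⁻¹`. [folklore] -/
theorem transportAut_model_apply (h : Field.absoluteGaloisGroup E) (hh) (x : AlgebraicClosure E') :
    (show AlgebraicClosure E' ≃ₐ[E'] AlgebraicClosure E' from transportAut Φ.toRingEquiv h hh) x =
      Φ ((show AlgebraicClosure E ≃ₐ[E] AlgebraicClosure E from h) (Φ.symm x)) :=
  transportAut_apply Φ.toRingEquiv h hh x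

/-- Values of `Φ⁻¹ t Φ`. [folklore] -/
theorem transportAut_model_symm_apply (t : Field.absoluteGaloisGroup E') (ht) (x : AlgebraicClosure E) :
    (show AlgebraicClosure E ≃ₐ[E] AlgebraicClosure E from transportAut Φ.toRingEquiv.symm t ht) x =
      Φ.symm ((show AlgebraicClosure E' ≃ₐ[E'] AlgebraicClosure E' from t) (Φ x)) :=
  transportAut_apply Φ.toRingEquiv.symm t ht x

/-- `Φ (Φ⁻¹ t Φ) Φ⁻¹ = t`. [folklore] -/
theorem transportAut_transportAut_symm_model (t : Field.absoluteGaloisGroup E') (ht) (hh) :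
    transportAut Φ.toRingEquiv (transportAut Φ.toRingEquiv.symm t ht) hh = t := by
  apply AlgEquiv.ext
  intro x
  rw [transportAut_model_apply, transportAut_model_symm_apply, AlgEquiv.apply_symm_apply,
    AlgEquiv.apply_symm_apply]

/-- `Φ⁻¹ (Φ h Φ⁻¹) Φ = h`. [folklore] -/
theorem transportAut_symm_transportAut_model (h : Field.absoluteGaloisGroup E) (hh) (ht) :
    transportAut Φ.toRingEquiv.symm (transportAut Φ.toRingEquiv h hh) ht = h := by
  apply AlgEquiv.ext
  intro x
  rw [transportAut_model_symm_apply, transportAut_model_apply, AlgEquiv.symm_apply_apply,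
    AlgEquiv.symm_apply_apply]

variable (ι : AlgebraicClosure K →ₐ[K] AlgebraicClosure E) (ι' : AlgebraicClosure K →ₐ[K] AlgebraicClosure E')
  (hcompat : ∀ z : AlgebraicClosure K, ι' z = Φ (ι z))

include hcompat in
/-- **The restrictions to `Γ_K` match**: `res_{ι'} (Φ h Φ⁻¹) = res_ι h` when `ι' = Φ ∘ ι` (both sides are characterised by
`emb ∘ res σ = σ ∘ emb`). [cite: SerreGaloisCohomology1997, II.§1.1] -/
theorem resGalOfEmb_transportAut_model (h : Field.absoluteGaloisGroup E) (hh) :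
    resGalOfEmb ι' (transportAut Φ.toRingEquiv h hh) = resGalOfEmb ι h := by
  apply AlgEquiv.ext
  intro z
  have h1 : ι' ((show AlgebraicClosure K ≃ₐ[K] AlgebraicClosure K from
      resGalOfEmb ι' (transportAut Φ.toRingEquiv h hh)) z) =
      (show AlgebraicClosure E' ≃ₐ[E'] AlgebraicClosure E' from transportAut Φ.toRingEquiv h hh) (ι' z) :=
    apply_resGalAuxOfEmb_apply ι' (transportAut Φ.toRingEquiv h hh) z
  have h2 : ι ((show AlgebraicClosure K ≃ₐ[K] AlgebraicClosure K from resGalOfEmb ι h) z) =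
      (show AlgebraicClosure E ≃ₐ[E] AlgebraicClosure E from h) (ι z) :=
    apply_resGalAuxOfEmb_apply ι h z
  have key : ι' ((show AlgebraicClosure K ≃ₐ[K] AlgebraicClosure K from
      resGalOfEmb ι' (transportAut Φ.toRingEquiv h hh)) z) =
      ι' ((show AlgebraicClosure K ≃ₐ[K] AlgebraicClosure K from resGalOfEmb ι h) z) := by
    rw [h1, transportAut_model_apply, hcompat, hcompat, AlgEquiv.symm_apply_apply, h2]
  exact ι'.injective key

include hcompat in
/-- **Local subgroups correspond**: `Φ h Φ⁻¹ ∈ H_{ι'} ↔ h ∈ H_ι` for every `H ≤ Γ_K`. [cite: SerreGaloisCohomology1997, II.§1.1]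
[cite: GreenbergLNM1716, §2] -/
theorem transportAut_mem_localSubgroupOfEmb_iff_model (H : Subgroup (Field.absoluteGaloisGroup K))
    (h : Field.absoluteGaloisGroup E) (hh) :
    transportAut Φ.toRingEquiv h hh ∈ localSubgroupOfEmb H ι' ↔ h ∈ localSubgroupOfEmb H ι := by
  rw [mem_localSubgroupOfEmb_iff, mem_localSubgroupOfEmb_iff, resGalOfEmb_transportAut_model Φ ι ι' hcompat]

include hf hcompat in
/-- `Φ⁻¹ t Φ ∈ H_ι ↔ t ∈ H_{ι'}`. [cite: SerreGaloisCohomology1997, II.§1.1] -/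
theorem transportAut_symm_mem_localSubgroupOfEmb_iff_model (H : Subgroup (Field.absoluteGaloisGroup K))
    (t : Field.absoluteGaloisGroup E') (ht) :
    transportAut Φ.toRingEquiv.symm t ht ∈ localSubgroupOfEmb H ι ↔ t ∈ localSubgroupOfEmb H ι' := by
  rw [← transportAut_mem_localSubgroupOfEmb_iff_model Φ ι ι' hcompat H _ (modelFix Φ φ hf _),
    transportAut_transportAut_symm_model]

/-! ## §2 The coordinate map `T = Φ_*` on points -/

variable (W : WeierstrassCurve K) (T : localPoints W E →+ localPoints W E')
  (hT : ∀ P : localPoints W E, T P =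
    WeierstrassCurve.Affine.Point.map (W' := W) (Φ : AlgebraicClosure E →ₐ[K] AlgebraicClosure E')
      (show (W.baseChange (AlgebraicClosure E)).toAffine.Point from P))

include hT in
/-- **`T` is `Φ(·)Φ⁻¹`-equivariant**: `T (h • P) = (Φ h Φ⁻¹) • T P`. [cite: SerreGaloisCohomology1997, I.§2.4]
[cite: SilvermanAEC2009, VIII.§1] -/
theorem modelMap_smul (h : Field.absoluteGaloisGroup E) (hh) (P : localPoints W E) :
    T (h • P) = transportAut Φ.toRingEquiv h hh • T P := by
  rw [hT, hT, localPoints.smul_def, localPoints.smul_def]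
  change WeierstrassCurve.Affine.Point.map _ (WeierstrassCurve.Affine.Point.map _ _) =
    WeierstrassCurve.Affine.Point.map _ (WeierstrassCurve.Affine.Point.map _ _)
  rw [WeierstrassCurve.Affine.Point.map_map, WeierstrassCurve.Affine.Point.map_map]
  have hF : (Φ : AlgebraicClosure E →ₐ[K] AlgebraicClosure E').comp
      ((AlgEquiv.restrictScalars K (show AlgebraicClosure E ≃ₐ[E] AlgebraicClosure E from h) :
          AlgebraicClosure E ≃ₐ[K] AlgebraicClosure E) : AlgebraicClosure E →ₐ[K] AlgebraicClosure E) =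
      ((AlgEquiv.restrictScalars K (show AlgebraicClosure E' ≃ₐ[E'] AlgebraicClosure E' from
          transportAut Φ.toRingEquiv h hh) : AlgebraicClosure E' ≃ₐ[K] AlgebraicClosure E') :
          AlgebraicClosure E' →ₐ[K] AlgebraicClosure E').comp
        (Φ : AlgebraicClosure E →ₐ[K] AlgebraicClosure E') := by
    apply AlgHom.ext
    intro x
    change Φ ((show AlgebraicClosure E ≃ₐ[E] AlgebraicClosure E from h) x) =
      (show AlgebraicClosure E' ≃ₐ[E'] AlgebraicClosure E' from transportAut Φ.toRingEquiv h hh) (Φ x)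
    rw [transportAut_model_apply, AlgEquiv.symm_apply_apply]
  exact congrArg (fun F ↦ WeierstrassCurve.Affine.Point.map F _) hF

include hT in
/-- `T` is surjective (`(Φ⁻¹)_*` is a right inverse). [cite: SilvermanAEC2009, VIII.§1] -/
theorem modelMap_surjective : Function.Surjective T := by
  intro Q
  refine ⟨WeierstrassCurve.Affine.Point.map (W' := W)
    ((Φ.symm : AlgebraicClosure E' ≃ₐ[K] AlgebraicClosure E) : AlgebraicClosure E' →ₐ[K] AlgebraicClosure E)
    (show (W.baseChange (AlgebraicClosure E')).toAffine.Point from Q), ?_⟩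
  rw [hT]
  change WeierstrassCurve.Affine.Point.map _ (WeierstrassCurve.Affine.Point.map _ _) = _
  rw [WeierstrassCurve.Affine.Point.map_map, AlgEquiv.comp_symm]
  change WeierstrassCurve.Affine.Point.map (AlgHom.id K (AlgebraicClosure E'))
    (show (W.baseChange (AlgebraicClosure E')).toAffine.Point from Q) = Q
  cases Q <;> rfl

variable {p : ℕ} [Fact p.Prime] (κ : ZpExtension K p)

include hf hcompat hT in
/-- **Layer points correspond**: `T P ∈ E(K_n·E') ↔ P ∈ E(K_n·E)` (the local subgroups `Gal(Ē/K_n·E)`, `Gal(Ē'/K_n·E')` correspond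
under `Φ(·)Φ⁻¹`, and `T` is equivariant and injective). [cite: Kobayashi2003, Def. 1.1] [cite: SerreGaloisCohomology1997, II.§1.1] -/
theorem modelMap_mem_localLayerPointsOfEmb_iff (n : ℕ) (P : localPoints W E) :
    T P ∈ localLayerPointsOfEmb κ ι' W n ↔ P ∈ localLayerPointsOfEmb κ ι W n := by
  rw [mem_localLayerPointsOfEmb_iff, mem_localLayerPointsOfEmb_iff]
  constructor
  · intro hTP τ hτ
    -- `T` is injective (`Point.map` of the injective `Φ`)
    have hinj : Function.Injective T := fun P Q hPQ ↦ by
      rw [hT, hT] at hPQ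
      exact WeierstrassCurve.Affine.Point.map_injective (W' := W) _ hPQ
    apply hinj
    rw [modelMap_smul Φ W T hT τ (modelFix Φ φ hf τ)]
    apply hTP
    change _ ∈ localSubgroupOfEmb (κ.layerSubgroup n) ι'
    rw [transportAut_mem_localSubgroupOfEmb_iff_model Φ ι ι' hcompat]
    exact hτ
  · intro hP t ht
    rw [← transportAut_transportAut_symm_model Φ t (modelFix_symm Φ φ hf t) (modelFix Φ φ hf _),
      ← modelMap_smul Φ W T hT, hP]
    change _ ∈ localSubgroupOfEmb (κ.layerSubgroup n) ι
    rw [transportAut_symm_mem_localSubgroupOfEmb_iff_model Φ φ hf ι ι' hcompat]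
    exact ht

include hf hcompat hT in
/-- **Traces correspond on layer points**: `T (Tr^{ι}_{k/m} P) = Tr^{ι'}_{k/m} (T P)` for `P ∈ E(K_k·E)`. `Φ(·)Φ⁻¹` is a bijection
`Gal(Ē/K_m·E) → Gal(Ē'/K_m·E')` carrying `Gal(Ē/K_k·E)` onto `Gal(Ē'/K_k·E')`, hence a bijection of the coset spaces; the trace of a
layer point is the sum over ANY system of representatives (`localTraceOfEmb_apply_eq_sum_of_mem`), and `T (g • P) = (Φ g Φ⁻¹) • T P`.
[cite: Kobayashi2003, Def. 1.1] [cite: SerreGaloisCohomology1997, II.§1.1] -/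
theorem modelMap_localTraceOfEmb (m k : ℕ) {P : localPoints W E} (hP : P ∈ localLayerPointsOfEmb κ ι W k) :
    T (localTraceOfEmb κ ι W m k P) = localTraceOfEmb κ ι' W m k (T P) := by
  set A₁ := localLayerSubgroupOfEmb κ ι m with hA₁
  set A₂ := localLayerSubgroupOfEmb κ ι k with hA₂
  set B₁ := localLayerSubgroupOfEmb κ ι' m with hB₁
  set B₂ := localLayerSubgroupOfEmb κ ι' k with hB₂
  -- `θ : A₁ → B₁`, `g ↦ Φ g Φ⁻¹`
  have hθmem : ∀ g : A₁, transportAut Φ.toRingEquiv (g : Field.absoluteGaloisGroup E) (modelFix Φ φ hf _) ∈ B₁ := by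
    intro g
    change _ ∈ localSubgroupOfEmb (κ.layerSubgroup m) ι'
    rw [transportAut_mem_localSubgroupOfEmb_iff_model Φ ι ι' hcompat]
    exact g.2
  let θ : A₁ → B₁ := fun g ↦ ⟨transportAut Φ.toRingEquiv (g : Field.absoluteGaloisGroup E) (modelFix Φ φ hf _), hθmem g⟩
  have hθcoe : ∀ g : A₁, ((θ g : B₁) : Field.absoluteGaloisGroup E') =
      transportAut Φ.toRingEquiv (g : Field.absoluteGaloisGroup E) (modelFix Φ φ hf _) := fun _ ↦ rfl
  have hθmul : ∀ g g' : A₁, θ (g * g') = θ g * θ g' := by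
    intro g g'
    apply Subtype.ext
    apply AlgEquiv.ext
    intro x
    change (show AlgebraicClosure E' ≃ₐ[E'] AlgebraicClosure E' from
        transportAut Φ.toRingEquiv ((g : Field.absoluteGaloisGroup E) * (g' : Field.absoluteGaloisGroup E))
          (modelFix Φ φ hf _)) x =
      (show AlgebraicClosure E' ≃ₐ[E'] AlgebraicClosure E' from
        transportAut Φ.toRingEquiv (g : Field.absoluteGaloisGroup E) (modelFix Φ φ hf _))
        ((show AlgebraicClosure E' ≃ₐ[E'] AlgebraicClosure E' from
          transportAut Φ.toRingEquiv (g' : Field.absoluteGaloisGroup E) (modelFix Φ φ hf _)) x)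
    rw [transportAut_model_apply, transportAut_model_apply, transportAut_model_apply, AlgEquiv.symm_apply_apply]
    rfl
  have hθone : θ 1 = 1 := by
    apply Subtype.ext
    apply AlgEquiv.ext
    intro x
    change (show AlgebraicClosure E' ≃ₐ[E'] AlgebraicClosure E' from
        transportAut Φ.toRingEquiv ((1 : A₁) : Field.absoluteGaloisGroup E) (modelFix Φ φ hf _)) x = x
    rw [transportAut_model_apply]
    exact Φ.apply_symm_apply x
  have hθinv : ∀ g : A₁, θ g⁻¹ = (θ g)⁻¹ := fun g ↦
    eq_inv_of_mul_eq_one_left (by rw [← hθmul, inv_mul_cancel, hθone])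
  have hθs : ∀ (g : A₁) (R : localPoints W E),
      T ((g : Field.absoluteGaloisGroup E) • R) = ((θ g : B₁) : Field.absoluteGaloisGroup E') • T R :=
    fun g R ↦ modelMap_smul Φ W T hT _ (modelFix Φ φ hf _) R
  -- `θ` carries `A₂` onto `B₂`
  have hrn : ∀ g : A₁, (g : Field.absoluteGaloisGroup E) ∈ A₂ ↔ ((θ g : B₁) : Field.absoluteGaloisGroup E') ∈ B₂ := by
    intro g
    rw [hθcoe]
    change _ ∈ localSubgroupOfEmb (κ.layerSubgroup k) ι ↔ _ ∈ localSubgroupOfEmb (κ.layerSubgroup k) ι'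
    rw [transportAut_mem_localSubgroupOfEmb_iff_model Φ ι ι' hcompat]
  -- `θ` is onto `B₁`
  have hθsurj : Function.Surjective θ := by
    intro b
    have hb : transportAut Φ.toRingEquiv.symm (b : Field.absoluteGaloisGroup E') (modelFix_symm Φ φ hf _) ∈ A₁ := by
      change _ ∈ localSubgroupOfEmb (κ.layerSubgroup m) ι
      rw [transportAut_symm_mem_localSubgroupOfEmb_iff_model Φ φ hf ι ι' hcompat]
      exact b.2
    refine ⟨⟨_, hb⟩, Subtype.ext ?_⟩
    rw [hθcoe]
    exact transportAut_transportAut_symm_model Φ _ (modelFix_symm Φ φ hf _) (modelFix Φ φ hf _)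
  haveI : Fintype (A₁ ⧸ A₂.subgroupOf A₁) := Fintype.ofFinite _
  haveI : Fintype (B₁ ⧸ B₂.subgroupOf B₁) := Fintype.ofFinite _
  -- representatives on the `E`-side and their images
  let s₂ : A₁ ⧸ A₂.subgroupOf A₁ → A₁ := fun q ↦ q.out
  have hs₂ : ∀ q, ((s₂ q : A₁) : A₁ ⧸ A₂.subgroupOf A₁) = q := fun q ↦ q.out_eq
  let ψ : A₁ ⧸ A₂.subgroupOf A₁ → B₁ ⧸ B₂.subgroupOf B₁ := fun q ↦ (θ (s₂ q) : B₁)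
  have hψmk : ∀ g : A₁, ψ (g : A₁ ⧸ A₂.subgroupOf A₁) = (θ g : B₁ ⧸ B₂.subgroupOf B₁) := by
    intro g
    apply QuotientGroup.eq.mpr
    rw [Subgroup.mem_subgroupOf, ← hθinv, ← hθmul, ← hrn]
    have h := QuotientGroup.eq.mp (hs₂ (g : A₁ ⧸ A₂.subgroupOf A₁))
    rw [Subgroup.mem_subgroupOf] at h
    exact h
  have hψinj : Function.Injective ψ := by
    intro a b hab
    rw [← hs₂ a, ← hs₂ b]
    apply QuotientGroup.eq.mpr
    rw [Subgroup.mem_subgroupOf]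
    have h := QuotientGroup.eq.mp hab
    rw [Subgroup.mem_subgroupOf, ← hθinv, ← hθmul, ← hrn] at h
    exact h
  have hψsurj : Function.Surjective ψ := by
    intro q
    induction q using QuotientGroup.induction_on with
    | H b =>
      obtain ⟨g, rfl⟩ := hθsurj b
      exact ⟨(g : A₁ ⧸ A₂.subgroupOf A₁), hψmk g⟩
  let e : (A₁ ⧸ A₂.subgroupOf A₁) ≃ (B₁ ⧸ B₂.subgroupOf B₁) := Equiv.ofBijective ψ ⟨hψinj, hψsurj⟩
  -- the transported system of representatives on the `E'`-side
  let s₁ : B₁ ⧸ B₂.subgroupOf B₁ → B₁ := fun q ↦ θ (s₂ (e.symm q))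
  have hs₁ : ∀ q, ((s₁ q : B₁) : B₁ ⧸ B₂.subgroupOf B₁) = q := fun q ↦ by
    change ψ (e.symm q) = q
    exact e.apply_symm_apply q
  -- both traces as sums over representatives
  have hTP : T P ∈ localLayerPointsOfEmb κ ι' W k :=
    (modelMap_mem_localLayerPointsOfEmb_iff Φ φ hf ι ι' hcompat W T hT κ k P).mpr hP
  rw [localTraceOfEmb_apply_eq_sum_of_mem κ ι' W m k hTP s₁ hs₁,
    localTraceOfEmb_apply_eq_sum_of_mem κ ι W m k hP s₂ hs₂, map_sum, ← e.sum_comp]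
  refine Finset.sum_congr rfl fun q _ ↦ ?_
  rw [hθs]
  change _ = ((θ (s₂ (e.symm (e q))) : B₁) : Field.absoluteGaloisGroup E') • T P
  rw [e.symm_apply_apply]

include hf hT in
/-- **Orbit closures correspond**: `T(ℤ[Γ_E]·d) = ℤ[Γ_{E'}]·(T d)` (`T (σ • d) = (Φ σ Φ⁻¹) • T d` and `Φ(·)Φ⁻¹` is onto `Γ_{E'}`).
[cite: SerreGaloisCohomology1997, II.§1.1] -/
theorem map_modelMap_closure_orbit (d : localPoints W E) :
    (AddSubgroup.closure (Set.range fun σ : Field.absoluteGaloisGroup E ↦ σ • d)).map T =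
      AddSubgroup.closure (Set.range fun σ' : Field.absoluteGaloisGroup E' ↦ σ' • T d) := by
  rw [AddMonoidHom.map_closure]
  congr 1
  ext x
  simp only [Set.mem_image, Set.mem_range]
  constructor
  · rintro ⟨_, ⟨σ, rfl⟩, rfl⟩
    exact ⟨transportAut Φ.toRingEquiv σ (modelFix Φ φ hf σ), (modelMap_smul Φ W T hT σ _ d).symm⟩
  · rintro ⟨σ', rfl⟩
    refine ⟨transportAut Φ.toRingEquiv.symm σ' (modelFix_symm Φ φ hf σ') • d, ⟨_, rfl⟩, ?_⟩
    rw [modelMap_smul Φ W T hT _ (modelFix Φ φ hf _), transportAut_transportAut_symm_model]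


end Generic

end Summit.BirchSwinnertonDyer.BirchSwinnertonDyer.Theorems.SignedEC

end
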